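import Literature.Geometry.Kaehler.ComplexTorusPolarizedAutomorphismsOrder
import Literature.Geometry.Kaehler.ComplexTorusAutomorphismOrder
import Literature.Geometry.Kaehler.ComplexTorusAutomorphismComplementaryPair
import Literature.GroupTheory.ArithmeticGroups.MinkowskiLemmaLocalRing
import HarnessLib

/-!
# Serre's lemma at level `2`: an automorphism of finite order of a complex torus which is the identity on the `2`-torsion is an involution (Silverberg–Zarhin 1996, §1, Thm. 6.2 for `k = 1`)

Layer `Literature/Geometry/Kaehler`, namespace `Literature.Geometry.Kaehler.ComplexTorus` (lane
`lit-hodgefound`, Layer A2, prover p38). Sequel of `ComplexTorusPolarizedAutomorphisms.lean` (Lange 2023,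
§2.4.1 Cor. 2.4.11: an automorphism of a polarised abelian variety which is the identity on `X_n`,
`n ≥ 3`, is the identity — `ComplexTorus.eq_id_of_forall_torsion_eq`) and of
`Literature/GroupTheory/ArithmeticGroups/MinkowskiLemmaLocalRing.lean` (`Γ(2)` has only `2`-torsion:
`Matrix.sq_eq_one_of_isOfFinOrder_of_two_dvd_sub_one`). Theorems only; no definition, no named fact.

A. Silverberg, Yu. G. Zarhin, *Variations on a theme of Minkowski and Serre*, J. Pure Appl. Algebra
111 (1996) 285–302 (held `paper:doi-10-1016-0022-4049-95-00113-1`), §1: "A result of Serre (see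
[SGA 7 I, Lemma 4.7.1] and [Serre, Rigidité du foncteur de Jacobi d'échelon `n ≥ 3`, Sém. Cartan
1960/61, Theorem on p. 17-19]) says that if an automorphism of finite order of a semi-abelian variety
induces the identity on the scheme-theoretic kernel of multiplication by `n`, then it is the identity
if `n ≥ 3`, and its square is the identity if `n = 2`. … Serre's Lemma relies on the fact that if
`n ≥ 3` then every root of unity which is congruent to `1` modulo `n` is `1`. This idea dates back to
Minkowski, who proved that an integral matrix of finite order, which is congruent to the identity
modulo `n`, is the identity if `n ≥ 3`"; §2 Definition 2.1: "`N(1) = {1, 2}`, … `R(1, 2) = 2`,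
`R(1, n) = 1` if `n ≥ 3`"; §6 Theorem 6.2 (`𝒪 = ℤ`, `k = 1`): "If `A ∈ M_g(𝒪)` is a matrix of finite
multiplicative order such that `A - I ∈ n M_g(𝒪)`, then `A^{R(1,n)} = I`"; Remark 3.2: "the upper
bound of `R(k, n)` on the order of `α` … is sharp" (`α` a primitive `R(k,n)`-th root of unity: here
`α = -1`).

## What is proved (complex tori `X = E/Φ(ℤ^ι)`; `X_2 = {x : 2x = 0}`)

* §1 finite-order holomorphic automorphisms (no polarisation): `f : X → X` holomorphic, `f 0 = 0`,
  `f^[k] = id` for some `k > 0`; if `f|_{X_n} = 1` with `n ≥ 3` then `f = id`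
  (`eq_id_of_iterate_eq_id_of_forall_torsion_eq`), and if `f|_{X_2} = 1` then `f ∘ f = id`
  (`comp_self_eq_id_of_iterate_eq_id_of_forall_two_torsion_eq`) — Serre's lemma as stated in §1,
  over `ℂ`, via the rational representation `f = ρ(A)`, `A ∈ M_{2g}(ℤ)` of finite order (Theorem 6.2
  with `𝒪 = ℤ`, `k = 1`: the tree's Minkowski lemma for `n ≥ 3`, and
  `Matrix.sq_eq_one_of_isOfFinOrder_of_two_dvd_sub_one` for `n = 2`).
* §2 automorphisms of a polarised abelian variety `(X, H)` (finite order is automatic, Lange Cor.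
  2.4.10 = `isOfFinOrder_of_mem_polarizedAut`): `sq_eq_one_of_mem_polarizedAut_of_two_dvd_sub_one`
  (`A ∈ Aut(X, H)`, `A ≡ 1 (mod 2)` ⟹ `A² = 1`), `comp_self_eq_id_of_forall_two_torsion_eq` (the
  holomorphic-map form: `f|_{X_2} = 1 ⟹ f ∘ f = id`), and the level-`2` analogue of the injectivity of
  `Aut(X, L) → Aut(X_n)`: two automorphisms agreeing on `X_2` differ by an involution of `(X, H)`
  (`exists_sq_eq_one_and_eq_mul_of_two_dvd_sub`).
* §3 the level-`2` kernel `K₂ = Aut(X, H) ∩ Γ(2) ≤ GL_{2g}(ℤ)`: every element is an involution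
  (`sq_eq_one_of_mem_polarizedAutUnits_inf_congruenceKer_two`), hence `K₂` is commutative — an
  elementary abelian `2`-group (`mul_comm_of_mem_polarizedAutUnits_inf_congruenceKer_two`); and
  `-1 ∈ K₂` (`neg_one_mem_polarizedAutUnits_inf_congruenceKer_two`), so for `X ≠ 0` the exponent
  `R(1, 2) = 2` cannot be improved (`exists_ne_one_mem_polarizedAutUnits_inf_congruenceKer_two`,
  Remark 3.2).

NOT here: semi-abelian varieties / base fields other than `ℂ` (the source's scheme-theoretic
setting), and the higher cases `(α - 1)^k ∈ n𝒪`, `k ≥ 2` (Theorems 3.1, 4.4, 6.2 in general).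

## References

* A. Silverberg, Yu. G. Zarhin, *Variations on a theme of Minkowski and Serre*, J. Pure Appl.
  Algebra 111 (1996), 285–302; §1, Def. 2.1, Thm. 6.2, Rem. 3.2. [SilverbergZarhin1996]
* H. Lange, *Abelian Varieties over the Complex Numbers* (2023), §2.4.1 Cor. 2.4.10, Cor. 2.4.11.
  [Lange2023AbelianVarietiesComplex]
* K. S. Brown, *Cohomology of Groups* (1982), Ch. II §4 Exercise 3 (b) (`Γ(2)` has only
  `2`-torsion). [Brown1982CohomologyGroups]
* H. Minkowski, J. Crelle 101 (1887), §1. [Minkowski1887]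
-/

open Complex Module
open scoped Manifold ContDiff Matrix MatrixGroups

namespace Literature.Geometry.Kaehler

namespace ComplexTorus

open Literature.GroupTheory.ArithmeticGroups

variable {ι : Type*} [Fintype ι] [DecidableEq ι] {E : Type*} [NormedAddCommGroup E] [NormedSpace ℂ E]
  (Φ : (ι → ℝ) ≃L[ℝ] E) {η : E [⋀^Fin 2]→L[ℝ] ℝ}

/-! ### §1 Finite-order holomorphic automorphisms which are the identity on `X_n` -/

/-- **Serre's lemma, `n ≥ 3`, for complex tori**: a holomorphic `f : X → X` with `f 0 = 0` of finite
order (`f^[k] = id`, `k > 0`) which is the identity on the `n`-torsion points, `n ≥ 3`, is the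
identity ("it is the identity if `n ≥ 3`"; `f = ρ(A)` with `A` of finite order and `A ≡ 1 (mod n)`,
Minkowski). [cite: SilverbergZarhin1996, §1 (Serre's lemma) and Theorem 6.2 (k = 1)] [cite: Minkowski1887, §1] -/
theorem eq_id_of_iterate_eq_id_of_forall_torsion_eq {f : ComplexTorus Φ → ComplexTorus Φ}
    (hf : MDifferentiable 𝓘(ℂ, E) 𝓘(ℂ, E) f) (h0 : f 0 = 0) {k : ℕ} (hk : 0 < k) (hper : f^[k] = id)
    {n : ℕ} (hn : 3 ≤ n) (hfix : ∀ x : ComplexTorus Φ, n • x = 0 → f x = x) : f = id := by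
  obtain ⟨A, -, -, -, rfl⟩ := exists_eq_mapMatrix_of_map_zero hf h0
  have hAk : A ^ k = 1 := (iterate_mapMatrix_eq_id_iff (Φ := Φ) A k).mp hper
  have hfin : IsOfFinOrder A := isOfFinOrder_iff_pow_eq_one.mpr ⟨k, hk, hAk⟩
  have hcong := forall_dvd_sub_one_of_forall_torsion_eq Φ (lt_of_lt_of_le (by norm_num) hn) hfix
  rw [Literature.GroupTheory.ArithmeticGroups.Matrix.eq_one_of_isOfFinOrder_of_dvd_sub_one hfin hn
    hcong]
  exact funext fun x ↦ mapMatrix_one x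

/-- **Serre's lemma, `n = 2`, for complex tori**: a holomorphic `f : X → X` with `f 0 = 0` of finite
order which is the identity on the `2`-torsion points `X_2` satisfies `f ∘ f = id` ("and its square is
the identity if `n = 2`"; `R(1, 2) = 2`). [cite: SilverbergZarhin1996, §1 (Serre's lemma), Definition 2.1 and Theorem 6.2 (k = 1, n = 2)] [cite: Brown1982CohomologyGroups, Ch. II §4 Exercise 3 (b)] -/
theorem comp_self_eq_id_of_iterate_eq_id_of_forall_two_torsion_eq {f : ComplexTorus Φ → ComplexTorus Φ}
    (hf : MDifferentiable 𝓘(ℂ, E) 𝓘(ℂ, E) f) (h0 : f 0 = 0) {k : ℕ} (hk : 0 < k) (hper : f^[k] = id)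
    (hfix : ∀ x : ComplexTorus Φ, 2 • x = 0 → f x = x) : f ∘ f = id := by
  obtain ⟨A, -, -, -, rfl⟩ := exists_eq_mapMatrix_of_map_zero hf h0
  have hAk : A ^ k = 1 := (iterate_mapMatrix_eq_id_iff (Φ := Φ) A k).mp hper
  have hfin : IsOfFinOrder A := isOfFinOrder_iff_pow_eq_one.mpr ⟨k, hk, hAk⟩
  have hcong := forall_dvd_sub_one_of_forall_torsion_eq Φ two_pos hfix
  have hsq : A ^ 2 = 1 :=
    Literature.GroupTheory.ArithmeticGroups.Matrix.sq_eq_one_of_isOfFinOrder_of_two_dvd_sub_one hfin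
      (fun i j => by exact_mod_cast hcong i j)
  funext x
  rw [Function.comp_apply, mapMatrix_mapMatrix, ← sq, hsq, mapMatrix_one, id]

/-! ### §2 Automorphisms of a polarised abelian variety which are the identity on `X_2` -/

/-- **`A ∈ Aut(X, H)`, `A ≡ 1 (mod 2)` ⟹ `A² = 1`** (rational representation; the finite order of
`A` is Lange's Cor. 2.4.10, `isOfFinOrder_of_mem_polarizedAut`).
[cite: SilverbergZarhin1996, §1 and Theorem 6.2 (k = 1, n = 2)] [cite: Lange2023AbelianVarietiesComplex, §2.4.1 Corollary 2.4.10] -/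
theorem sq_eq_one_of_mem_polarizedAut_of_two_dvd_sub_one (h₁₁ : ∀ u v : E, η ![I • u, I • v] = η ![u, v])
    (hpos : ∀ u : E, u ≠ 0 → 0 < η ![I • u, u]) {A : Matrix ι ι ℤ} (hA : A ∈ polarizedAut Φ η)
    (hcong : ∀ i j, (2 : ℤ) ∣ (A - 1) i j) : A ^ 2 = 1 :=
  Literature.GroupTheory.ArithmeticGroups.Matrix.sq_eq_one_of_isOfFinOrder_of_two_dvd_sub_one
    (isOfFinOrder_of_mem_polarizedAut Φ h₁₁ hpos hA) hcong

/-- **An automorphism of a polarised abelian variety which is the identity on `X_2` is an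
involution**, for holomorphic maps: `η` of type `(1,1)` with `η(iu, u) > 0`, `f` holomorphic with
`f 0 = 0` and `η(df u, df v) = η(u, v)`; if `f x = x` whenever `2x = 0` then `f ∘ f = id`.
[cite: SilverbergZarhin1996, §1 and Theorem 6.2 (k = 1, n = 2)] [cite: Lange2023AbelianVarietiesComplex, §2.4.1 Corollary 2.4.11 (the case n ≥ 3)] -/
theorem comp_self_eq_id_of_forall_two_torsion_eq (h₁₁ : ∀ u v : E, η ![I • u, I • v] = η ![u, v])
    (hpos : ∀ u : E, u ≠ 0 → 0 < η ![I • u, u]) {f : ComplexTorus Φ → ComplexTorus Φ}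
    (hf : MDifferentiable 𝓘(ℂ, E) 𝓘(ℂ, E) f) (h0 : f 0 = 0)
    (hη : ∀ u v : E,
      η ![mfderiv 𝓘(ℂ, E) 𝓘(ℂ, E) f 0 u, mfderiv 𝓘(ℂ, E) 𝓘(ℂ, E) f 0 v] = η ![u, v])
    (hfix : ∀ x : ComplexTorus Φ, 2 • x = 0 → f x = x) : f ∘ f = id := by
  obtain ⟨A, hA, rfl⟩ := exists_mem_polarizedAut_eq_mapMatrix Φ hf h0 hη
  have hcong := forall_dvd_sub_one_of_forall_torsion_eq Φ two_pos hfix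
  have hsq := sq_eq_one_of_mem_polarizedAut_of_two_dvd_sub_one Φ h₁₁ hpos hA
    (fun i j => by exact_mod_cast hcong i j)
  funext x
  rw [Function.comp_apply, mapMatrix_mapMatrix, ← sq, hsq, mapMatrix_one, id]

/-- **Two automorphisms of `(X, H)` which agree on `X_2` differ by an involution of `(X, H)`**: if
`A, B ∈ Aut(X, H)` and `A ≡ B (mod 2)` then `A = B C` with `C ∈ Aut(X, H)`, `C² = 1` (the level-`2`
analogue of the embedding `Aut(X, L) ↪ GL_{2g}(ℤ/nℤ)`, `n ≥ 3`).
[cite: SilverbergZarhin1996, §1 and Theorem 6.2 (k = 1, n = 2)] [cite: Lange2023AbelianVarietiesComplex, §2.4.1, remark after Corollary 2.4.11, p. 117] -/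
theorem exists_sq_eq_one_and_eq_mul_of_two_dvd_sub (h₁₁ : ∀ u v : E, η ![I • u, I • v] = η ![u, v])
    (hpos : ∀ u : E, u ≠ 0 → 0 < η ![I • u, u]) {A B : Matrix ι ι ℤ} (hA : A ∈ polarizedAut Φ η)
    (hB : B ∈ polarizedAut Φ η) (hcong : ∀ i j, (2 : ℤ) ∣ (A - B) i j) :
    ∃ C ∈ polarizedAut Φ η, C ^ 2 = 1 ∧ A = B * C := by
  have hG := isUnit_det_latticeGram Φ h₁₁ hpos
  have hBu : IsUnit B.det := isUnit_det_of_mem_polarizedAut Φ hG hB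
  have hBinv : B⁻¹ ∈ polarizedAut Φ η := inv_mem_polarizedAut Φ hG hB
  refine ⟨B⁻¹ * A, (polarizedAut Φ η).mul_mem hBinv hA, ?_, ?_⟩
  · refine sq_eq_one_of_mem_polarizedAut_of_two_dvd_sub_one Φ h₁₁ hpos
      ((polarizedAut Φ η).mul_mem hBinv hA) fun i j => ?_
    have hfac : B⁻¹ * A - 1 = B⁻¹ * (A - B) := by
      rw [Matrix.mul_sub, Matrix.nonsing_inv_mul _ hBu]
    rw [hfac, Matrix.mul_apply]
    exact Finset.dvd_sum fun k _ => dvd_mul_of_dvd_right (hcong k j) _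
  · rw [← Matrix.mul_assoc, Matrix.mul_nonsing_inv _ hBu, Matrix.one_mul]

/-! ### §3 The level-`2` kernel `K₂ = Aut(X, H) ∩ Γ(2)` is an elementary abelian `2`-group containing `-1` -/

/-- **Every element of `K₂ = Aut(X, H) ∩ Γ(2)` is an involution** (`Γ(2) = congruenceKer ι 2`, the
tree's principal congruence subgroup of `GL_{2g}(ℤ)`).
[cite: SilverbergZarhin1996, §1 and Theorem 6.2 (k = 1, n = 2)] [cite: Brown1982CohomologyGroups, Ch. II §4 Exercise 3 (b)] -/
theorem sq_eq_one_of_mem_polarizedAutUnits_inf_congruenceKer_two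
    (h₁₁ : ∀ u v : E, η ![I • u, I • v] = η ![u, v]) (hpos : ∀ u : E, u ≠ 0 → 0 < η ![I • u, u])
    {g : GL ι ℤ}
    (hg : g ∈ polarizedAutUnits Φ η ⊓ Literature.LinearAlgebra.Matrix.congruenceKer ι 2) :
    g ^ 2 = 1 := by
  have hfin : IsOfFinOrder g := by
    have h := isOfFinOrder_of_mem_polarizedAut Φ h₁₁ hpos (Subgroup.mem_inf.mp hg).1.1
    -- `IsOfFinOrder (g : Matrix ι ι ℤ)` ⟹ `IsOfFinOrder g`
    obtain ⟨k, hk, hgk⟩ := isOfFinOrder_iff_pow_eq_one.mp h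
    exact isOfFinOrder_iff_pow_eq_one.mpr
      ⟨k, hk, Units.ext (by rw [Units.val_pow_eq_pow_val, hgk, Units.val_one])⟩
  exact sq_eq_one_of_mem_congruenceKer_two (Subgroup.mem_inf.mp hg).2 hfin

/-- **`K₂ = Aut(X, H) ∩ Γ(2)` is commutative** (a group all of whose elements are involutions is an
elementary abelian `2`-group). [cite: SilverbergZarhin1996, §1 and Theorem 6.2 (k = 1, n = 2)] -/
theorem mul_comm_of_mem_polarizedAutUnits_inf_congruenceKer_two
    (h₁₁ : ∀ u v : E, η ![I • u, I • v] = η ![u, v]) (hpos : ∀ u : E, u ≠ 0 → 0 < η ![I • u, u])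
    {g h : GL ι ℤ}
    (hg : g ∈ polarizedAutUnits Φ η ⊓ Literature.LinearAlgebra.Matrix.congruenceKer ι 2)
    (hh : h ∈ polarizedAutUnits Φ η ⊓ Literature.LinearAlgebra.Matrix.congruenceKer ι 2) :
    g * h = h * g := by
  set K := polarizedAutUnits Φ η ⊓ Literature.LinearAlgebra.Matrix.congruenceKer ι 2
  have hsq : ∀ x ∈ K, x * x = 1 := fun x hx => by
    rw [← sq]; exact sq_eq_one_of_mem_polarizedAutUnits_inf_congruenceKer_two Φ h₁₁ hpos hx
  have hg2 := hsq g hg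
  have hh2 := hsq h hh
  have hgh2 := hsq (g * h) (K.mul_mem hg hh)
  -- `g² = h² = (gh)² = 1` ⟹ `gh = (gh)⁻¹ = h⁻¹ g⁻¹ = h g`
  have hginv : g⁻¹ = g := inv_eq_of_mul_eq_one_right hg2
  have hhinv : h⁻¹ = h := inv_eq_of_mul_eq_one_right hh2
  have hghinv : (g * h)⁻¹ = g * h := inv_eq_of_mul_eq_one_right hgh2
  calc g * h = (g * h)⁻¹ := hghinv.symm
    _ = h⁻¹ * g⁻¹ := mul_inv_rev g h
    _ = h * g := by rw [hginv, hhinv]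

/-- **`-1 ∈ K₂`**: `-1_X` is an automorphism of `(X, H)` congruent to `1` mod `2`.
[cite: SilverbergZarhin1996, Remark 3.2 (sharpness of R(k, n); R(1, 2) = 2)] [cite: Lange2023AbelianVarietiesComplex, §2.4.1, p. 116] -/
theorem neg_one_mem_polarizedAutUnits_inf_congruenceKer_two (η : E [⋀^Fin 2]→L[ℝ] ℝ) :
    (-1 : GL ι ℤ) ∈ polarizedAutUnits Φ η ⊓ Literature.LinearAlgebra.Matrix.congruenceKer ι 2 := by
  refine Subgroup.mem_inf.mpr ⟨?_, ?_⟩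
  · rw [mem_polarizedAutUnits_iff']
    refine ⟨?_, ?_⟩
    · rw [Units.val_neg, Units.val_one]; exact neg_one_mem_polarizedAut Φ η
    · rw [inv_neg, inv_one, Units.val_neg, Units.val_one]; exact neg_one_mem_polarizedAut Φ η
  · rw [Literature.LinearAlgebra.Matrix.mem_congruenceKer_iff]
    intro i j
    rw [Units.val_neg, Units.val_one, Matrix.sub_apply, Matrix.neg_apply]
    by_cases hij : i = j
    · subst hij
      rw [Matrix.one_apply_eq]
      exact ⟨-1, by norm_num⟩
    · rw [Matrix.one_apply_ne hij]
      simp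

/-- **Sharpness of `R(1, 2) = 2`**: for `X ≠ 0` the kernel `K₂` is not trivial (`-1 ≠ 1`), so
"the identity on `X_2`" does not force "the identity". [cite: SilverbergZarhin1996, Remark 3.2] -/
theorem exists_ne_one_mem_polarizedAutUnits_inf_congruenceKer_two [Nonempty ι]
    (η : E [⋀^Fin 2]→L[ℝ] ℝ) :
    ∃ g ∈ polarizedAutUnits Φ η ⊓ Literature.LinearAlgebra.Matrix.congruenceKer ι 2, g ≠ 1 := by
  refine ⟨-1, neg_one_mem_polarizedAutUnits_inf_congruenceKer_two Φ η, fun h => ?_⟩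
  obtain ⟨i⟩ := ‹Nonempty ι›
  have h1 := congr_arg (fun u : GL ι ℤ => (u : Matrix ι ι ℤ) i i) h
  simp only [Units.val_neg, Units.val_one, Matrix.neg_apply, Matrix.one_apply_eq] at h1
  norm_num at h1

end ComplexTorus

end Literature.Geometry.Kaehler
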